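import Summits.AtomisticToContinuum.BoseEinsteinCondensation.Theses.BECDyadicChaining
import Literature.MathematicalPhysics.QuantumManyBody.DyadicCoherentFractionRefinement
import Literature.MathematicalPhysics.QuantumManyBody.BoseGasMergeOccupation

/-!
# Route `BECDyadicChaining` — support item `CoherentAmplitudeMonotone` (stmt-AtomisticToContinuum-13195)

Closes stmt-AtomisticToContinuum-13195, the exact signature of
`Summit.AtomisticToContinuum.BoseEinsteinCondensation.Theses.BECDyadicChaining.CoherentAmplitudeMonotone`:
for every `N`, `L`, every Dirichlet trial state `Ψ ∈ TrialState N L` and every dyadic level `m ≥ 1` the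
COHERENT AMPLITUDE `A_m(Ψ) = 8^{-m/2} ∑_{C ∈ level m} √⟨φ_C, γ_Ψ φ_C⟩` (flat modes
`φ_C = (L/2^m)^{-3/2} 1_C` of the open dyadic cubes `C` of side `L/2^m`) is non-decreasing:
`A_{m-1} ≤ A_m`.

Proof (the Hilbert-space reading of `occupation`, [LSSY2005, §1.2 (1.17)]). For `N = n + 1`,
`⟨φ, γ_Ψ φ⟩ = (n+1) ‖u_φ‖²_{L²(dY)}` with the Gram vector `u_φ(Y) = ∫ conj(φ(x)) Ψ(x, Y) dx`
(`rpow_half_occupation_succ`). For a parent cube `P` with its eight children `C`,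
`φ_P = 8^{-1/2} ∑_C φ_C` a.e., so `8 |u_P(Y)|² = |∑_C u_C(Y)|²` for every `Y`
(`eight_mul_sq_pairing_parent_le`; the junk value `0` of a non-integrable slice only helps), and
Minkowski's inequality in `L²(dY)` (`eLpNorm'_sum_le`) gives `√8 √⟨φ_P, γ φ_P⟩ ≤ ∑_C √⟨φ_C, γ φ_C⟩`
(`sqrt8_mul_rpow_half_occupation_dyMode_le`). Summing over the parents of level `k` and using
`8^{-k/2} = 8^{-(k+1)/2} 8^{1/2}` gives the claim for the half-open cells `dyCell` of
`DyadicCoherentFraction.lean` (`coherentAmplitude_dyMode_le_succ`); the route's OPEN cubes differ from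
them by coordinate hyperplanes, a Lebesgue-null set, and `occupation` only sees the mode a.e.
(`openCell_ae_eq_dyCell`, `occupation_congr_ae`).

No new definitions; everything is over `Literature.MathematicalPhysics.QuantumManyBody.BoseGas`
(`occupation`, `TrialState`, `dyCell`, `dyMode`, `dyChild`).
-/

noncomputable section

namespace Summit.AtomisticToContinuum.BoseEinsteinCondensation.Theorems

open MeasureTheory
open scoped ENNReal NNReal ComplexConjugate
open Literature.MathematicalPhysics.QuantumManyBody.BoseGas

namespace CoherentAmplitudeMonotone

/-- **`occupation` is `N` times a squared `L²` norm.** For `N = n + 1` particles,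
`⟨φ, γ_Ψ φ⟩^{1/2} = (n+1)^{1/2} ‖u_φ‖_{L²(dY)}` with the Gram vector
`u_φ(Y) = ∫ conj(φ(x)) Ψ(x, Y) dx ∈ L²((ℝ³)^n)`. [cite: LSSY2005, §1.2 (1.17)] -/
theorem rpow_half_occupation_succ (n : ℕ) (φ : Space → ℂ) (Ψ : Config (n + 1) → ℂ) :
    (occupation (n + 1) φ Ψ) ^ (1 / 2 : ℝ) = ((n : ℝ≥0∞) + 1) ^ (1 / 2 : ℝ) *
      eLpNorm' (fun Y : Config n => ∫ x, conj (φ x) * Ψ (Matrix.vecCons x Y)) 2 volume := by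
  rw [occupation_succ, ENNReal.mul_rpow_of_nonneg _ _ (by norm_num : (0 : ℝ) ≤ 1 / 2),
    eLpNorm'_eq_lintegral_enorm]
  simp only [enorm_eq_nnnorm, ENNReal.rpow_two]

/-- **One parent against its eight children, pointwise in the bath configuration.** For `L > 0`,
a parent cell `P` of level `k` with children `C_c`, and every `Y`:
`8 |∫ conj(φ_P) Ψ(·,Y)|² ≤ |∑_c ∫ conj(φ_{C_c}) Ψ(·,Y)|²` — an equality when `x ↦ Ψ(x,Y)` is
integrable on `P` (`φ_P = 8^{-1/2} ∑_c φ_{C_c}`, i.e. `8 (s³)⁻¹ = ((s/2)³)⁻¹` and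
`∫_P = ∑_c ∫_{C_c}`), and `0 ≤ ·` otherwise (junk value of the Bochner integral). [folklore] -/
theorem eight_mul_sq_pairing_parent_le {n : ℕ} {L : ℝ} (hL : 0 < L) (k : ℕ)
    (m : Fin 3 → Fin (2 ^ k)) (Ψ : Config (n + 1) → ℂ) (Y : Config n) :
    8 * ((‖∫ x, conj (dyMode L k m x) * Ψ (Matrix.vecCons x Y)‖₊ : ℝ≥0∞) ^ 2) ≤
      ((‖∑ c : Fin 3 → Fin 2, ∫ x, conj (dyMode L (k + 1) (dyChild m c) x) *
        Ψ (Matrix.vecCons x Y)‖₊ : ℝ≥0∞) ^ 2) := by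
  simp only [integral_conj_dyMode_mul, side_succ L k]
  rw [← Finset.mul_sum]
  have hs : 0 < L / 2 ^ k := by positivity
  have h8 : (8 : ℝ) * ((Real.sqrt ((L / 2 ^ k) ^ 3))⁻¹) ^ 2 =
      ((Real.sqrt ((L / 2 ^ k / 2) ^ 3))⁻¹) ^ 2 := by
    rw [inv_pow, inv_pow, Real.sq_sqrt (by positivity), Real.sq_sqrt (by positivity)]
    field_simp
    ring
  by_cases hint : IntegrableOn (fun x => Ψ (Matrix.vecCons x Y)) (dyCell L k m)
  · rw [setIntegral_dyCell_eq_sum_dyChild m hint]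
    simp only [nnnorm_coe_sq_eq_ofReal]
    rw [show (8 : ℝ≥0∞) = ENNReal.ofReal 8 by norm_num, ← ENNReal.ofReal_mul (by norm_num)]
    refine ENNReal.ofReal_le_ofReal (le_of_eq ?_)
    rw [norm_mul, norm_mul, norm_inv, norm_inv, Complex.norm_real, Complex.norm_real,
      Real.norm_of_nonneg (Real.sqrt_nonneg _), Real.norm_of_nonneg (Real.sqrt_nonneg _), mul_pow,
      mul_pow, ← mul_assoc, h8]
  · rw [integral_undef hint]
    simp

/-- **Triangle inequality for the eight child Gram vectors.** For a measurable `(n+1)`-body wave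
function, a cell `P` of level `k` and its children `C_c`:
`√8 · ⟨φ_P, γ_Ψ φ_P⟩^{1/2} ≤ ∑_c ⟨φ_{C_c}, γ_Ψ φ_{C_c}⟩^{1/2}` — the norm of the sum is at most the
sum of the norms in `L²((ℝ³)^n)` (Minkowski), after `8 |u_P|² = |∑_c u_{C_c}|²` pointwise. [folklore] -/
theorem sqrt8_mul_rpow_half_occupation_dyMode_le {n : ℕ} (L : ℝ) (k : ℕ) (m : Fin 3 → Fin (2 ^ k))
    {Ψ : Config (n + 1) → ℂ} (hΨ : Measurable Ψ) :
    (8 : ℝ≥0∞) ^ (1 / 2 : ℝ) * (occupation (n + 1) (dyMode L k m) Ψ) ^ (1 / 2 : ℝ) ≤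
      ∑ c : Fin 3 → Fin 2, (occupation (n + 1) (dyMode L (k + 1) (dyChild m c)) Ψ) ^ (1 / 2 : ℝ) := by
  rcases le_or_gt L 0 with hL | hL
  · have h0 : dyMode L k m = fun _ => 0 := by
      rw [dyMode, dyCell_eq_empty hL, Set.indicator_empty]
    have hocc : occupation (n + 1) (dyMode L k m) Ψ = 0 := by
      simp [occupation_succ, h0]
    rw [hocc, ENNReal.zero_rpow_of_pos (by norm_num), mul_zero]
    exact bot_le
  -- the eight child Gram vectors
  set u : (Fin 3 → Fin 2) → Config n → ℂ := fun c Y =>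
    ∫ x, conj (dyMode L (k + 1) (dyChild m c) x) * Ψ (Matrix.vecCons x Y) with hu
  have hmeas : ∀ c, AEStronglyMeasurable (u c) volume := fun c => by
    simp only [hu, integral_conj_dyMode_mul]
    exact ((measurable_setIntegral_vecCons hΨ _).const_mul _).aestronglyMeasurable
  have hhalf : (0 : ℝ) ≤ 1 / 2 := by norm_num
  calc (8 : ℝ≥0∞) ^ (1 / 2 : ℝ) * (occupation (n + 1) (dyMode L k m) Ψ) ^ (1 / 2 : ℝ)
      = (8 * occupation (n + 1) (dyMode L k m) Ψ) ^ (1 / 2 : ℝ) := by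
        rw [ENNReal.mul_rpow_of_nonneg _ _ hhalf]
    _ ≤ (((n : ℝ≥0∞) + 1) * ∫⁻ Y, (‖(∑ c, u c) Y‖₊ : ℝ≥0∞) ^ 2) ^ (1 / 2 : ℝ) := by
        refine ENNReal.rpow_le_rpow ?_ hhalf
        rw [occupation_succ, mul_left_comm,
          ← lintegral_const_mul' (8 : ℝ≥0∞) _ (by simp : (8 : ℝ≥0∞) ≠ ⊤)]
        refine mul_le_mul_right (lintegral_mono fun Y => ?_) _
        rw [Finset.sum_apply]
        exact eight_mul_sq_pairing_parent_le hL k m Ψ Y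
    _ = ((n : ℝ≥0∞) + 1) ^ (1 / 2 : ℝ) * eLpNorm' (∑ c, u c) 2 volume := by
        rw [ENNReal.mul_rpow_of_nonneg _ _ hhalf, eLpNorm'_eq_lintegral_enorm]
        simp only [enorm_eq_nnnorm, ENNReal.rpow_two]
    _ ≤ ((n : ℝ≥0∞) + 1) ^ (1 / 2 : ℝ) * ∑ c, eLpNorm' (u c) 2 volume := by
        gcongr
        exact eLpNorm'_sum_le (fun c _ => hmeas c) (by norm_num)
    _ = ∑ c, (occupation (n + 1) (dyMode L (k + 1) (dyChild m c)) Ψ) ^ (1 / 2 : ℝ) := by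
        rw [Finset.mul_sum]
        refine Finset.sum_congr rfl fun c _ => ?_
        rw [rpow_half_occupation_succ]

/-- **Refinement monotonicity of the coherent amplitude (half-open cells).** For a measurable
`N`-body wave function and every level `k`,
`8^{-k/2} ∑_{|C| = L/2^k} ⟨φ_C, γ_Ψ φ_C⟩^{1/2} ≤ 8^{-(k+1)/2} ∑_{|C| = L/2^{k+1}} ⟨φ_C, γ_Ψ φ_C⟩^{1/2}`
over the flat modes `dyMode` of the half-open dyadic cells: sum the eight-children inequality over the
parents (the children of distinct parents are distinct, `dyChild_injective2`) and use
`8^{-k/2} = 8^{-(k+1)/2} · 8^{1/2}`. [folklore] -/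
theorem coherentAmplitude_dyMode_le_succ (N : ℕ) (L : ℝ) {Ψ : Config N → ℂ} (hΨ : Measurable Ψ)
    (k : ℕ) :
    (8 : ℝ≥0∞) ^ (-(k : ℝ) / 2) *
        ∑ i : Fin 3 → Fin (2 ^ k), (occupation N (dyMode L k i) Ψ) ^ (1 / 2 : ℝ) ≤
      (8 : ℝ≥0∞) ^ (-((k + 1 : ℕ) : ℝ) / 2) *
        ∑ i : Fin 3 → Fin (2 ^ (k + 1)), (occupation N (dyMode L (k + 1) i) Ψ) ^ (1 / 2 : ℝ) := by
  cases N with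
  | zero => simp [occupation]
  | succ n =>
    have h8 : (8 : ℝ≥0∞) ^ (-(k : ℝ) / 2) =
        (8 : ℝ≥0∞) ^ (-((k + 1 : ℕ) : ℝ) / 2) * (8 : ℝ≥0∞) ^ (1 / 2 : ℝ) := by
      rw [← ENNReal.rpow_add _ _ (by norm_num : (8 : ℝ≥0∞) ≠ 0) (by simp : (8 : ℝ≥0∞) ≠ ⊤)]
      congr 1
      push_cast
      ring
    calc (8 : ℝ≥0∞) ^ (-(k : ℝ) / 2) *
          ∑ i : Fin 3 → Fin (2 ^ k), (occupation (n + 1) (dyMode L k i) Ψ) ^ (1 / 2 : ℝ)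
        = (8 : ℝ≥0∞) ^ (-((k + 1 : ℕ) : ℝ) / 2) * ∑ i : Fin 3 → Fin (2 ^ k),
            (8 : ℝ≥0∞) ^ (1 / 2 : ℝ) * (occupation (n + 1) (dyMode L k i) Ψ) ^ (1 / 2 : ℝ) := by
          rw [h8, mul_assoc, Finset.mul_sum]
      _ ≤ (8 : ℝ≥0∞) ^ (-((k + 1 : ℕ) : ℝ) / 2) * ∑ i : Fin 3 → Fin (2 ^ k), ∑ c : Fin 3 → Fin 2,
            (occupation (n + 1) (dyMode L (k + 1) (dyChild i c)) Ψ) ^ (1 / 2 : ℝ) := by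
          gcongr with i
          exact sqrt8_mul_rpow_half_occupation_dyMode_le L k i hΨ
      _ ≤ (8 : ℝ≥0∞) ^ (-((k + 1 : ℕ) : ℝ) / 2) *
            ∑ i : Fin 3 → Fin (2 ^ (k + 1)), (occupation (n + 1) (dyMode L (k + 1) i) Ψ) ^ (1 / 2 : ℝ) := by
          gcongr
          calc ∑ i : Fin 3 → Fin (2 ^ k), ∑ c : Fin 3 → Fin 2,
                (occupation (n + 1) (dyMode L (k + 1) (dyChild i c)) Ψ) ^ (1 / 2 : ℝ)
              = ∑ q ∈ (Finset.univ.image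
                    fun p : (Fin 3 → Fin (2 ^ k)) × (Fin 3 → Fin 2) => dyChild p.1 p.2),
                  (occupation (n + 1) (dyMode L (k + 1) q) Ψ) ^ (1 / 2 : ℝ) := by
                rw [Finset.sum_image fun p _ q _ h => dyChild_injective2 h,
                  ← Finset.univ_product_univ, Finset.sum_product]
            _ ≤ _ := Finset.sum_le_sum_of_subset (Finset.subset_univ _)

/-- The route's OPEN dyadic cube `∏_j (i_j L/2^k, (i_j+1) L/2^k)` and the half-open cell
`dyCell L k i` coincide up to a Lebesgue-null set (coordinate hyperplanes are null for the product
Lebesgue measure, transported to `EuclideanSpace ℝ (Fin 3)` by the measure-preserving `ofLp`).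
[folklore] -/
theorem openCell_ae_eq_dyCell (L : ℝ) (k : ℕ) (i : Fin 3 → Fin (2 ^ k)) :
    ({x : EuclideanSpace ℝ (Fin 3) | ∀ j : Fin 3, x j ∈ Set.Ioo (((i j : ℕ) : ℝ) * (L / 2 ^ k))
      ((((i j : ℕ) : ℝ) + 1) * (L / 2 ^ k))} : Set Space) =ᵐ[volume] dyCell L k i := by
  have h1 : ({x : EuclideanSpace ℝ (Fin 3) | ∀ j : Fin 3, x j ∈ Set.Ioo (((i j : ℕ) : ℝ) * (L / 2 ^ k))
      ((((i j : ℕ) : ℝ) + 1) * (L / 2 ^ k))} : Set Space) =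
      (WithLp.ofLp : EuclideanSpace ℝ (Fin 3) → (Fin 3 → ℝ)) ⁻¹' Set.univ.pi fun j =>
        Set.Ioo ((((i j : ℕ) : ℝ)) * (L / 2 ^ k)) ((((i j : ℕ) : ℝ) + 1) * (L / 2 ^ k)) := by
    ext x; simp
  have h2 : (Set.univ.pi fun j : Fin 3 =>
        Set.Ioo ((((i j : ℕ) : ℝ)) * (L / 2 ^ k)) ((((i j : ℕ) : ℝ) + 1) * (L / 2 ^ k))) =ᵐ[volume]
      Set.univ.pi fun j : Fin 3 =>
        Set.Ico ((((i j : ℕ) : ℝ)) * (L / 2 ^ k)) ((((i j : ℕ) : ℝ) + 1) * (L / 2 ^ k)) := by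
    rw [volume_pi]
    exact Measure.pi_Ioo_ae_eq_pi_Icc.trans Measure.pi_Ico_ae_eq_pi_Icc.symm
  rw [h1, dyCell_eq_preimage]
  exact (PiLp.volume_preserving_ofLp (Fin 3)).quasiMeasurePreserving.preimage_ae_eq h2

/-- **Refinement monotonicity of the coherent amplitude (the route's open cubes).** For a Dirichlet
trial state `Ψ ∈ TrialState N L` and every level `k`: `A_k ≤ A_{k+1}`, where
`A_k = 8^{-k/2} ∑_i ⟨φ_{k,i}, γ_Ψ φ_{k,i}⟩^{1/2}` over the flat modes of the open dyadic cubes of side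
`L/2^k` — the open cubes are a.e. the half-open cells, and `occupation` depends on the mode only
a.e. (`occupation_congr_ae`). [folklore] -/
theorem coherentAmplitude_le_succ (N : ℕ) (L : ℝ) (Ψ : TrialState N L) (k : ℕ) :
    (8 : ℝ≥0∞) ^ (-(k : ℝ) / 2) * ∑ i : Fin 3 → Fin (2 ^ k), (occupation N (Set.indicator
        {x : EuclideanSpace ℝ (Fin 3) | ∀ j : Fin 3, x j ∈ Set.Ioo (((i j : ℕ) : ℝ) * (L / 2 ^ k))
          ((((i j : ℕ) : ℝ) + 1) * (L / 2 ^ k))}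
        (fun _ => ((Real.sqrt ((L / 2 ^ k) ^ 3))⁻¹ : ℂ))) Ψ.ψ) ^ (1 / 2 : ℝ) ≤
      (8 : ℝ≥0∞) ^ (-((k + 1 : ℕ) : ℝ) / 2) * ∑ i : Fin 3 → Fin (2 ^ (k + 1)), (occupation N
        (Set.indicator {x : EuclideanSpace ℝ (Fin 3) | ∀ j : Fin 3, x j ∈
          Set.Ioo (((i j : ℕ) : ℝ) * (L / 2 ^ (k + 1))) ((((i j : ℕ) : ℝ) + 1) * (L / 2 ^ (k + 1)))}
        (fun _ => ((Real.sqrt ((L / 2 ^ (k + 1)) ^ 3))⁻¹ : ℂ))) Ψ.ψ) ^ (1 / 2 : ℝ) := by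
  have h : ∀ (k : ℕ) (i : Fin 3 → Fin (2 ^ k)), occupation N (Set.indicator
        {x : EuclideanSpace ℝ (Fin 3) | ∀ j : Fin 3, x j ∈ Set.Ioo (((i j : ℕ) : ℝ) * (L / 2 ^ k))
          ((((i j : ℕ) : ℝ) + 1) * (L / 2 ^ k))}
        (fun _ => ((Real.sqrt ((L / 2 ^ k) ^ 3))⁻¹ : ℂ))) Ψ.ψ = occupation N (dyMode L k i) Ψ.ψ :=
    fun k i => occupation_congr_ae (indicator_ae_eq_of_ae_eq_set (openCell_ae_eq_dyCell L k i)) Ψ.ψ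
  simp only [h]
  exact coherentAmplitude_dyMode_le_succ N L Ψ.contDiff.continuous.measurable k

end CoherentAmplitudeMonotone

/-- **Item `CoherentAmplitudeMonotone` of route `BECDyadicChaining` (stmt-AtomisticToContinuum-13195).**
For every `N`, `L`, every Dirichlet trial state `Ψ` and every level `m ≥ 1`: `A_{m-1} ≤ A_m` for the
coherent amplitude `A_m = 8^{-m/2} ∑_{C ∈ level m} √⟨φ_C, γ_Ψ φ_C⟩` of the dyadic block condensates
(norm of the sum ≤ sum of the norms for the eight child Gram vectors of each parent cube).
[cite: LSSY2005, §1.2 (1.17)] -/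
theorem coherentAmplitudeMonotone_proof :
    Summit.AtomisticToContinuum.BoseEinsteinCondensation.Theses.BECDyadicChaining.CoherentAmplitudeMonotone := by
  intro N L Ψ m hm
  obtain ⟨k, rfl⟩ : ∃ k, m = k + 1 := ⟨m - 1, by omega⟩
  exact CoherentAmplitudeMonotone.coherentAmplitude_le_succ N L Ψ k

end Summit.AtomisticToContinuum.BoseEinsteinCondensation.Theorems

end
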